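import Summits.QuantumFields.BalabanUV.Beta.GAN24.AliasStripSymbols

/-!
# `BalabanUV.Beta.GAN24.AliasStripSymbolsSum` — binder row G-an2-4 / (CONV-C), road P1-fibre, p1 row **P1-L10** `FibreStrip`, sub-row **F2** of the L10 cut
# «(M4) scaled alias-space Neumann, two anchors» (`HOME/b2b-balaban-gan24-formalise-leaf-16/L10-CUT-M4.md`), PART 3: the block-average GEOMETRIC SUMS
# `G(z, n) = FibreSymbols.gsum z n = Σ_{t<n} e^{izt}` at a COMPLEX argument — strip weight form, numerator form, products, strip-Lipschitz

NOT IN PRINT; OUR PROOF ATTEMPT.  HONEST FRAMING (cell contract, verbatim): «discharging `BetaPertH` makes Bałaban's UV stability UNCONDITIONAL — a real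
constructive-QFT result; it is NOT the continuum limit and NOT the Clay problem.»  HONEST DEPENDENCY (verbatim): «continuum YM on T⁴ ⇐ BetaPertH ∧ nine spine
estimates (0/9 proved); BetaPertH ⇐ (D1) ∧ (D4) ∧ CAP+tail; G-an2-4 gates asym, D1 and NE2/3/4.»  [folklore] complex trigonometry on top of `GAN24/AliasWeights` (real
argument) and part 1 `GAN24/AliasStripSymbols`; no cited fact, no `def … : Prop`, no wall binder; constants explicit (`e^{2ρ}`, `e^{4ρ}`, and the numerals `15 ≥ 2e²`,
`56 ≥ 2e² + 2e³` under `n|Im z| ≤ 1`, `n‖h‖ ≤ 1`).  Discharges NOTHING of the K-slot `GAN24.CombesThomas.ConvCK 3 Lc`; NOT `BetaPertH`, NOT continuum, NOT Clay.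

## What is proved (`z h : ℂ`, `n : ℕ`, `x = Re z`; the one-coordinate weight `sinWt n x = min(1, (n sin(x/2))⁻²)` of `AliasWeights`)
§1 `gsum z n · (e^{iz} − 1) = e^{izn} − 1` (BY NAME from `AliasWeights`), the closed form off `e^{iz} = 1`, `‖e^{izn} − 1‖ ≤ e^ρ + 1`
   and `‖gsum z n‖ ≤ n e^ρ` under the STRIP SIZE `|Im z|·n ≤ ρ` (alias reading: `z = k_{m,i} = (p_i + 2πm_i)/N`, `n = N`, `ρ ≥ |Im p_i|`).
§2 WEIGHT FORMS: `‖gsum z n‖ ≤ e^{2ρ}/|sin(x/2)|`, hence **`‖gsum z n‖² ≤ e^{4ρ}·n²·sinWt n x`** (the real-zone majorant of `AliasWeights.norm_geomExp_sq_le` times ONE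
   constant), the NUMERATOR form `‖gsum z n‖ ≤ ‖e^{izn} − 1‖·e^{|Im z|/2}/(2|sin(x/2)|)` (carries `‖e^{ip_i} − 1‖ = O(|p|)` in the inner region), and the product forms
   for `S = Π_i G(z_i, n)` and `S·s_κ`.
§3 STRIP-LIPSCHITZ under a complex shift `h` (imaginary `h = iy` for the outer anchor, `h = p/N` for the inner one): the termwise identity
   `gsum (z+h) n − gsum z n = Σ_t e^{izt}(e^{iht} − 1)` with `‖·‖ ≤ n²(|Re h| + |Im h|)e^{n(|Im z| + |Im h|)}` (`≤ 15 n²‖h‖` when `n|Im z|, n‖h‖ ≤ 1`), the closed-form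
   regime `|sin(x/2)| ≥ 1/n`: `‖·‖ ≤ 56·n‖h‖/|sin(x/2)|`, and the unified squared weight form **`‖gsum (z+h) n − gsum z n‖² ≤ 56²·(n‖h‖)²·(n²·sinWt n x)`**
   — i.e. `|ΔG| ≲ n|h|·min(n, 1/|sin(x/2)|)`, the SAME majorant as the weight itself times the relative size `n‖h‖`.
Consumed by F4/F6 (border Frobenius sums via `AliasWeightsSum.sum_prod_wMaj_le`) and F5/F8 (strip leg weights) of the cut.

Unit `b2b-balaban-gan24-formalise-leaf-19` (G-an2-4 formalisation swarm, leaf prover 19), 2026-08-20.  Value = kernel bookkeeping toward the K-slot route P1, NOT summit progress.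
-/

noncomputable section

open Complex Finset
open scoped BigOperators Real

namespace Summit.QuantumFields.BalabanUV.Beta.GAN24.AliasStripSymbolsSum

open FibreSymbols (gsum)
open AliasWeights (sinWt sinWt_pos norm_cexp_I_mul_mul_nat)
open AliasStripSymbols (norm_cexp_I_mul norm_cexp_I_mul_le two_mul_exp_mul_abs_sin_le_norm_of_im cexp_I_mul_ne_one
  norm_cexp_I_mul_sub_one_le' norm_cexp_I_mul_sub_one_le_two_mul)

variable {D : ℕ}

/-! ## §1 Closed form, periodicity, strip size -/

/-- [folklore] `gsum` IS the `Finset.range` sum of `GAN24/AliasWeights` (definitional). -/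
theorem gsum_eq_sum (z : ℂ) (n : ℕ) : gsum z n = ∑ t ∈ Finset.range n, cexp (I * z * t) := rfl

/-- [folklore] `gsum z 0 = 0`. -/
theorem gsum_zero_right (z : ℂ) : gsum z 0 = 0 := by simp [gsum_eq_sum]

/-- [folklore] `gsum z n · (e^{iz} − 1) = e^{izn} − 1` (any complex `z`; `AliasWeights.geomExp_mul_sub_one` BY NAME). -/
theorem gsum_mul_sub_one (z : ℂ) (n : ℕ) : gsum z n * (cexp (I * z) - 1) = cexp (I * z * n) - 1 :=
  AliasWeights.geomExp_mul_sub_one z n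

/-- [folklore] CLOSED FORM off the zone centre: `e^{iz} ≠ 1 ⇒ gsum z n = (e^{izn} − 1)/(e^{iz} − 1)`. -/
theorem gsum_eq_div {z : ℂ} (hz : cexp (I * z) ≠ 1) (n : ℕ) : gsum z n = (cexp (I * z * n) - 1) / (cexp (I * z) - 1) := by
  rw [eq_div_iff (sub_ne_zero.2 hz), gsum_mul_sub_one]

/-- [folklore] The strip-size hypothesis `|Im z|·n ≤ ρ` forces `0 ≤ ρ`. -/
theorem rho_nonneg_of_im {z : ℂ} {n : ℕ} {ρ : ℝ} (hρ : |z.im| * n ≤ ρ) : 0 ≤ ρ :=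
  (mul_nonneg (abs_nonneg _) (Nat.cast_nonneg n)).trans hρ

/-- [folklore] … and, for `n ≥ 1`, `|Im z| ≤ ρ`. -/
theorem abs_im_le_of_im {z : ℂ} {n : ℕ} {ρ : ℝ} (hρ : |z.im| * n ≤ ρ) (hn : 1 ≤ n) : |z.im| ≤ ρ := by
  have hn' : (1 : ℝ) ≤ n := by exact_mod_cast hn
  nlinarith [abs_nonneg z.im]

/-- [folklore] `‖e^{izn}‖ ≤ e^ρ` under `|Im z|·n ≤ ρ`. -/
theorem norm_cexp_I_mul_mul_nat_le {z : ℂ} {n : ℕ} {ρ : ℝ} (hρ : |z.im| * n ≤ ρ) : ‖cexp (I * z * n)‖ ≤ Real.exp ρ := by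
  rw [norm_cexp_I_mul_mul_nat]
  refine Real.exp_le_exp.2 ?_
  nlinarith [neg_abs_le z.im, Nat.cast_nonneg (α := ℝ) n]

/-- [folklore] `‖e^{izn} − 1‖ ≤ e^ρ + 1` under `|Im z|·n ≤ ρ`. -/
theorem norm_cexp_I_mul_mul_nat_sub_one_le {z : ℂ} {n : ℕ} {ρ : ℝ} (hρ : |z.im| * n ≤ ρ) : ‖cexp (I * z * n) - 1‖ ≤ Real.exp ρ + 1 :=
  (norm_sub_le _ _).trans (by rw [norm_one]; linarith [norm_cexp_I_mul_mul_nat_le hρ])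

/-- [folklore] STRIP BOUND `‖gsum z n‖ ≤ n·e^ρ` under `|Im z|·n ≤ ρ` (`AliasWeights.norm_geomExp_le_of_im` BY NAME). -/
theorem norm_gsum_le_of_im (z : ℂ) (n : ℕ) {ρ : ℝ} (hρ : |z.im| * n ≤ ρ) : ‖gsum z n‖ ≤ n * Real.exp ρ :=
  AliasWeights.norm_geomExp_le_of_im z n hρ

/-! ## §2 Weight forms -/

/-- [folklore] **INVERSE-SINE FORM ON THE STRIP**: `|Im z|·n ≤ ρ`, `sin(x/2) ≠ 0 ⇒ ‖gsum z n‖ ≤ e^{2ρ}/|sin(x/2)|`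
(from `‖gsum‖·‖e^{iz} − 1‖ = ‖e^{izn} − 1‖ ≤ 2e^ρ` and `‖e^{iz} − 1‖ ≥ 2e^{−ρ/2}|sin(x/2)|`). -/
theorem norm_gsum_le_inv_sin {z : ℂ} {n : ℕ} {ρ : ℝ} (hρ : |z.im| * n ≤ ρ) (hs : Real.sin (z.re / 2) ≠ 0) :
    ‖gsum z n‖ ≤ Real.exp (2 * ρ) / |Real.sin (z.re / 2)| := by
  have hs' : 0 < |Real.sin (z.re / 2)| := abs_pos.2 hs
  have hρ0 := rho_nonneg_of_im hρ
  rcases Nat.eq_zero_or_pos n with hn | hn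
  · subst hn; rw [gsum_zero_right, norm_zero]; positivity
  have him : |z.im| ≤ ρ := abs_im_le_of_im hρ hn
  have hden := two_mul_exp_mul_abs_sin_le_norm_of_im (w := z) him
  have hnum := norm_cexp_I_mul_mul_nat_sub_one_le hρ
  have hprod : ‖gsum z n‖ * (2 * Real.exp (-ρ / 2) * |Real.sin (z.re / 2)|) ≤ Real.exp ρ + 1 := by
    calc ‖gsum z n‖ * (2 * Real.exp (-ρ / 2) * |Real.sin (z.re / 2)|) ≤ ‖gsum z n‖ * ‖cexp (I * z) - 1‖ :=
          mul_le_mul_of_nonneg_left hden (norm_nonneg _)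
      _ = ‖cexp (I * z * n) - 1‖ := by rw [← norm_mul, gsum_mul_sub_one]
      _ ≤ Real.exp ρ + 1 := hnum
  have h1 : 1 ≤ Real.exp ρ := Real.one_le_exp hρ0
  have hE : Real.exp (2 * ρ) * Real.exp (-ρ / 2) = Real.exp (3 * ρ / 2) := by rw [← Real.exp_add]; ring_nf
  have hE2 : Real.exp ρ ≤ Real.exp (3 * ρ / 2) := Real.exp_le_exp.2 (by linarith)
  have hpos : 0 < Real.exp (-ρ / 2) := Real.exp_pos _
  rw [le_div_iff₀ hs']
  have key : ‖gsum z n‖ * |Real.sin (z.re / 2)| * Real.exp (-ρ / 2) ≤ Real.exp ρ := by nlinarith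
  have key2 : ‖gsum z n‖ * |Real.sin (z.re / 2)| * Real.exp (-ρ / 2) ≤ Real.exp (2 * ρ) * Real.exp (-ρ / 2) := by
    rw [hE]; exact key.trans hE2
  exact le_of_mul_le_mul_right key2 hpos

/-- [folklore] **SQUARED WEIGHT FORM ON THE STRIP**: `|Im z|·n ≤ ρ ⇒ ‖gsum z n‖² ≤ e^{4ρ}·n²·sinWt n (Re z)` — the real-zone majorant `min(n², sin(x/2)⁻²)`
times the single constant `e^{4ρ}`. -/
theorem norm_gsum_sq_le {z : ℂ} {n : ℕ} {ρ : ℝ} (hρ : |z.im| * n ≤ ρ) :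
    ‖gsum z n‖ ^ 2 ≤ Real.exp (4 * ρ) * ((n : ℝ) ^ 2 * sinWt n z.re) := by
  have hρ0 := rho_nonneg_of_im hρ
  set A := ‖gsum z n‖ with hA
  have hA0 : 0 ≤ A := norm_nonneg _
  have hAN : A ≤ n * Real.exp ρ := norm_gsum_le_of_im z n hρ
  have he1 : 1 ≤ Real.exp (2 * ρ) := Real.one_le_exp (by linarith)
  have he4 : Real.exp ρ ^ 2 = Real.exp (2 * ρ) := by rw [sq, ← Real.exp_add]; ring_nf
  have he8 : Real.exp (2 * ρ) ^ 2 = Real.exp (4 * ρ) := by rw [sq, ← Real.exp_add]; ring_nf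
  unfold AliasWeights.sinWt
  rcases le_or_gt (((n : ℝ) * Real.sin (z.re / 2)) ^ 2) 1 with h | h
  · rw [max_eq_left h, div_one, mul_one]
    calc A ^ 2 ≤ (n * Real.exp ρ) ^ 2 := pow_le_pow_left₀ hA0 hAN 2
      _ = n ^ 2 * Real.exp (2 * ρ) := by rw [mul_pow, he4]
      _ ≤ n ^ 2 * Real.exp (2 * ρ) * Real.exp (2 * ρ) := le_mul_of_one_le_right (by positivity) he1
      _ = Real.exp (4 * ρ) * n ^ 2 := by rw [← he8]; ring
  · rw [max_eq_right h.le]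
    have hs : Real.sin (z.re / 2) ≠ 0 := by intro h0; rw [h0, mul_zero] at h; norm_num at h
    have hN : (n : ℝ) ≠ 0 := by intro h0; rw [h0, zero_mul] at h; norm_num at h
    have hAs : A ≤ Real.exp (2 * ρ) / |Real.sin (z.re / 2)| := norm_gsum_le_inv_sin hρ hs
    calc A ^ 2 ≤ (Real.exp (2 * ρ) / |Real.sin (z.re / 2)|) ^ 2 := pow_le_pow_left₀ hA0 hAs 2
      _ = Real.exp (4 * ρ) * ((n : ℝ) ^ 2 * (1 / ((n : ℝ) * Real.sin (z.re / 2)) ^ 2)) := by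
          rw [div_pow, sq_abs, he8, mul_pow]
          field_simp

/-- [folklore] **NUMERATOR FORM**: `sin(x/2) ≠ 0 ⇒ ‖gsum z n‖ ≤ ‖e^{izn} − 1‖·e^{|Im z|/2}/(2|sin(x/2)|)` — at an alias momentum `zn = p_i + 2πm_i`, so by
periodicity (`GAN24/AliasReindex.cexp_I_mul_add_two_pi_mul'`, already landed) the numerator is `‖e^{ip_i} − 1‖ ≤ (|Re p_i| + |Im p_i|)e^{|Im p_i|}` (part 1):
the inner region's `O(|p|)`. -/
theorem norm_gsum_le_numer {z : ℂ} (n : ℕ) (hs : Real.sin (z.re / 2) ≠ 0) :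
    ‖gsum z n‖ ≤ ‖cexp (I * z * n) - 1‖ * Real.exp (|z.im| / 2) / (2 * |Real.sin (z.re / 2)|) := by
  have hs' : 0 < |Real.sin (z.re / 2)| := abs_pos.2 hs
  have hden := two_mul_exp_mul_abs_sin_le_norm_of_im (w := z) (le_refl |z.im|)
  have hprod : ‖gsum z n‖ * (2 * Real.exp (-|z.im| / 2) * |Real.sin (z.re / 2)|) ≤ ‖cexp (I * z * n) - 1‖ := by
    calc ‖gsum z n‖ * (2 * Real.exp (-|z.im| / 2) * |Real.sin (z.re / 2)|) ≤ ‖gsum z n‖ * ‖cexp (I * z) - 1‖ :=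
          mul_le_mul_of_nonneg_left hden (norm_nonneg _)
      _ = ‖cexp (I * z * n) - 1‖ := by rw [← norm_mul, gsum_mul_sub_one]
  have hE : Real.exp (-|z.im| / 2) * Real.exp (|z.im| / 2) = 1 := by
    rw [← Real.exp_add, show -|z.im| / 2 + |z.im| / 2 = 0 by ring, Real.exp_zero]
  have hpos : 0 < Real.exp (|z.im| / 2) := Real.exp_pos _
  rw [le_div_iff₀ (by positivity)]
  have e1 : ‖gsum z n‖ * (2 * |Real.sin (z.re / 2)|)
      = ‖gsum z n‖ * (2 * Real.exp (-|z.im| / 2) * |Real.sin (z.re / 2)|) * Real.exp (|z.im| / 2) := by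
    calc ‖gsum z n‖ * (2 * |Real.sin (z.re / 2)|)
        = ‖gsum z n‖ * (2 * |Real.sin (z.re / 2)|) * (Real.exp (-|z.im| / 2) * Real.exp (|z.im| / 2)) := by rw [hE, mul_one]
      _ = _ := by ring
  rw [e1]
  exact mul_le_mul_of_nonneg_right hprod hpos.le

/-- [folklore] WEIGHT PRODUCT for `S(m) = Π_i G(z_i, n)` on the strip: `‖Π_i gsum z_i n‖² ≤ (e^{4ρ} n²)^D · Π_i sinWt n (Re z_i)` under `|Im z_i|·n ≤ ρ ∀ i`. -/
theorem norm_prod_gsum_sq_le (z : Fin D → ℂ) (n : ℕ) {ρ : ℝ} (hρ : ∀ i, |(z i).im| * n ≤ ρ) :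
    ‖∏ i, gsum (z i) n‖ ^ 2 ≤ (Real.exp (4 * ρ) * (n : ℝ) ^ 2) ^ D * ∏ i, sinWt n (z i).re := by
  rw [norm_prod, ← Finset.prod_pow,
    show (Real.exp (4 * ρ) * (n : ℝ) ^ 2) ^ D = ∏ _i : Fin D, (Real.exp (4 * ρ) * (n : ℝ) ^ 2) by
      rw [Finset.prod_const, Finset.card_univ, Fintype.card_fin],
    ← Finset.prod_mul_distrib]
  exact Finset.prod_le_prod (fun i _ => by positivity) fun i _ => by rw [mul_assoc]; exact norm_gsum_sq_le (hρ i)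

/-- [folklore] WEIGHT PRODUCT for `S(m)·s_κ(m)` on the strip: `‖(Π_i gsum z_i n)·gsum z_κ n‖² ≤ (e^{4ρ}n²)^D (e^{4ρ}n²) · (Π_i sinWt n (Re z_i))·sinWt n (Re z_κ)`. -/
theorem norm_prod_gsum_mul_sq_le (z : Fin D → ℂ) (κ : Fin D) (n : ℕ) {ρ : ℝ} (hρ : ∀ i, |(z i).im| * n ≤ ρ) :
    ‖(∏ i, gsum (z i) n) * gsum (z κ) n‖ ^ 2
      ≤ (Real.exp (4 * ρ) * (n : ℝ) ^ 2) ^ D * (Real.exp (4 * ρ) * (n : ℝ) ^ 2) * ((∏ i, sinWt n (z i).re) * sinWt n (z κ).re) := by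
  rw [norm_mul, mul_pow]
  have h1 := norm_prod_gsum_sq_le z n hρ
  have h2 := norm_gsum_sq_le (hρ κ)
  calc ‖∏ i, gsum (z i) n‖ ^ 2 * ‖gsum (z κ) n‖ ^ 2
      ≤ ((Real.exp (4 * ρ) * (n : ℝ) ^ 2) ^ D * ∏ i, sinWt n (z i).re) * (Real.exp (4 * ρ) * ((n : ℝ) ^ 2 * sinWt n (z κ).re)) :=
        mul_le_mul h1 h2 (by positivity) (mul_nonneg (by positivity) (Finset.prod_nonneg fun _ _ => (sinWt_pos _ _).le))
    _ = _ := by ring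

/-! ## §3 Strip-Lipschitz: `gsum (z + h) n − gsum z n` for a complex shift `h` -/

/-- [folklore] TERMWISE IDENTITY `gsum (z+h) n − gsum z n = Σ_{t<n} e^{izt}(e^{iht} − 1)`. -/
theorem gsum_add_sub (z h : ℂ) (n : ℕ) :
    gsum (z + h) n - gsum z n = ∑ t ∈ Finset.range n, cexp (I * z * t) * (cexp (I * h * t) - 1) := by
  rw [gsum_eq_sum, gsum_eq_sum, ← Finset.sum_sub_distrib]
  refine Finset.sum_congr rfl fun t _ => ?_
  rw [show I * (z + h) * (t : ℂ) = I * z * t + I * h * t by ring, Complex.exp_add]; ring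

/-- [folklore] **TERMWISE LIPSCHITZ BOUND** (always valid; the right one when `|sin(x/2)| ≤ 1/n`):
`‖gsum (z+h) n − gsum z n‖ ≤ n²·(|Re h| + |Im h|)·e^{n(|Im z| + |Im h|)}`. -/
theorem norm_gsum_add_sub_le (z h : ℂ) (n : ℕ) :
    ‖gsum (z + h) n - gsum z n‖ ≤ (n : ℝ) ^ 2 * ((|h.re| + |h.im|) * Real.exp (n * (|z.im| + |h.im|))) := by
  rw [gsum_add_sub]
  have hterm : ∀ t ∈ Finset.range n,
      ‖cexp (I * z * t) * (cexp (I * h * t) - 1)‖ ≤ n * ((|h.re| + |h.im|) * Real.exp (n * (|z.im| + |h.im|))) := by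
    intro t ht
    have ht' : (t : ℝ) ≤ n := by exact_mod_cast (Finset.mem_range.1 ht).le
    have ht0 : (0 : ℝ) ≤ t := Nat.cast_nonneg t
    rw [norm_mul]
    have f1 : ‖cexp (I * z * t)‖ ≤ Real.exp (n * |z.im|) := by
      rw [norm_cexp_I_mul_mul_nat]
      refine Real.exp_le_exp.2 ?_
      nlinarith [neg_abs_le z.im, abs_nonneg z.im]
    have f2 : ‖cexp (I * h * t) - 1‖ ≤ n * (|h.re| + |h.im|) * Real.exp (n * |h.im|) := by
      rw [mul_assoc]
      refine (norm_cexp_I_mul_sub_one_le' (h * t)).trans ?_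
      have hre : (h * (t : ℂ)).re = h.re * t := by simp [Complex.mul_re]
      have him : (h * (t : ℂ)).im = h.im * t := by simp [Complex.mul_im]
      rw [hre, him, abs_mul, abs_mul, Nat.abs_cast]
      have e1 : Real.exp (|h.im| * t) ≤ Real.exp (n * |h.im|) := Real.exp_le_exp.2 (by nlinarith [abs_nonneg h.im])
      calc (|h.re| * t + |h.im| * t) * Real.exp (|h.im| * t) ≤ (|h.re| * n + |h.im| * n) * Real.exp (n * |h.im|) :=
            mul_le_mul (by nlinarith [abs_nonneg h.re, abs_nonneg h.im]) e1 (by positivity) (by positivity)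
        _ = n * (|h.re| + |h.im|) * Real.exp (n * |h.im|) := by ring
    calc ‖cexp (I * z * t)‖ * ‖cexp (I * h * t) - 1‖ ≤ Real.exp (n * |z.im|) * (n * (|h.re| + |h.im|) * Real.exp (n * |h.im|)) :=
          mul_le_mul f1 f2 (norm_nonneg _) (by positivity)
      _ = n * ((|h.re| + |h.im|) * Real.exp (n * (|z.im| + |h.im|))) := by rw [mul_add (n : ℝ) |z.im|, Real.exp_add]; ring
  calc ‖∑ t ∈ Finset.range n, cexp (I * z * t) * (cexp (I * h * t) - 1)‖
      ≤ ∑ t ∈ Finset.range n, ‖cexp (I * z * t) * (cexp (I * h * t) - 1)‖ := norm_sum_le _ _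
    _ ≤ ∑ _t ∈ Finset.range n, (n : ℝ) * ((|h.re| + |h.im|) * Real.exp (n * (|z.im| + |h.im|))) := Finset.sum_le_sum hterm
    _ = (n : ℝ) ^ 2 * ((|h.re| + |h.im|) * Real.exp (n * (|z.im| + |h.im|))) := by
        rw [Finset.sum_const, Finset.card_range, nsmul_eq_mul]; ring

/-- [folklore] Numeric termwise form: `n|Im z| ≤ 1`, `n‖h‖ ≤ 1 ⇒ ‖gsum (z+h) n − gsum z n‖ ≤ 15·n²·‖h‖` (`15 ≥ 2e²`). -/
theorem norm_gsum_add_sub_le_num {z h : ℂ} {n : ℕ} (hz : n * |z.im| ≤ 1) (hh : n * ‖h‖ ≤ 1) :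
    ‖gsum (z + h) n - gsum z n‖ ≤ 15 * (n : ℝ) ^ 2 * ‖h‖ := by
  refine (norm_gsum_add_sub_le z h n).trans ?_
  have hre : |h.re| ≤ ‖h‖ := Complex.abs_re_le_norm h
  have him : |h.im| ≤ ‖h‖ := Complex.abs_im_le_norm h
  have hn0 : (0 : ℝ) ≤ n := Nat.cast_nonneg n
  have h1 : (n : ℝ) * (|z.im| + |h.im|) ≤ 2 := by nlinarith
  have h2 : Real.exp (n * (|z.im| + |h.im|)) ≤ Real.exp 1 * Real.exp 1 := by
    rw [← Real.exp_add]; exact Real.exp_le_exp.2 (by linarith)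
  have he := Real.exp_one_lt_d9
  have h3 : Real.exp (n * (|z.im| + |h.im|)) ≤ 7.39 := by nlinarith [Real.exp_pos (1 : ℝ)]
  calc (n : ℝ) ^ 2 * ((|h.re| + |h.im|) * Real.exp (n * (|z.im| + |h.im|))) ≤ (n : ℝ) ^ 2 * ((2 * ‖h‖) * 7.39) :=
        mul_le_mul_of_nonneg_left (mul_le_mul (by linarith) h3 (by positivity) (by positivity)) (by positivity)
    _ ≤ 15 * (n : ℝ) ^ 2 * ‖h‖ := by nlinarith [norm_nonneg h, sq_nonneg (n : ℝ)]

/-- [folklore] CLOSED-FORM DIFFERENCE off the zone centre: with `e^{iz} ≠ 1`, `e^{i(z+h)} ≠ 1`,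
`gsum (z+h) n − gsum z n = (e^{i(z+h)n} − e^{izn})/(e^{i(z+h)} − 1) + gsum z n · (e^{iz} − e^{i(z+h)})/(e^{i(z+h)} − 1)`. -/
theorem gsum_add_sub_eq_div {z h : ℂ} (n : ℕ) (hz : cexp (I * z) ≠ 1) (hzh : cexp (I * (z + h)) ≠ 1) :
    gsum (z + h) n - gsum z n
      = (cexp (I * (z + h) * n) - cexp (I * z * n)) / (cexp (I * (z + h)) - 1)
        + gsum z n * ((cexp (I * z) - cexp (I * (z + h))) / (cexp (I * (z + h)) - 1)) := by
  have h1 : cexp (I * (z + h)) - 1 ≠ 0 := sub_ne_zero.2 hzh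
  have h2 : cexp (I * z) - 1 ≠ 0 := sub_ne_zero.2 hz
  rw [gsum_eq_div hzh, gsum_eq_div hz]
  field_simp
  ring

/-- [folklore] **CLOSED-FORM REGIME** `|sin(x/2)| ≥ 1/n` (`n ≥ 1`, `n|Im z| ≤ 1`, `n‖h‖ ≤ 1`): `‖gsum (z+h) n − gsum z n‖ ≤ 56·n‖h‖/|sin(x/2)|`
(`56 ≥ 2e² + 2e³`: first term `e·2n‖h‖`, second `ne·e·2‖h‖`, common denominator `‖e^{i(z+h)} − 1‖ ≥ e^{−1}|sin(x/2)|` because the shifted sine loses at most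
`|Re h|/2 ≤ 1/(2n) ≤ |sin(x/2)|/2`). -/
theorem norm_gsum_add_sub_le_inv_sin {z h : ℂ} {n : ℕ} (hn : 1 ≤ n) (hz : n * |z.im| ≤ 1) (hh : n * ‖h‖ ≤ 1)
    (hs : 1 / (n : ℝ) ≤ |Real.sin (z.re / 2)|) :
    ‖gsum (z + h) n - gsum z n‖ ≤ 56 * n * ‖h‖ / |Real.sin (z.re / 2)| := by
  have hn' : (1 : ℝ) ≤ n := by exact_mod_cast hn
  have hn0 : (0 : ℝ) < n := by linarith
  set s := Real.sin (z.re / 2) with hs_def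
  have hs0 : 0 < |s| := lt_of_lt_of_le (one_div_pos.2 hn0) hs
  have hsn : 1 ≤ (n : ℝ) * |s| := by
    have := mul_le_mul_of_nonneg_left hs hn0.le
    rwa [mul_one_div_cancel hn0.ne'] at this
  -- sizes
  have hzim : |z.im| ≤ 1 := by nlinarith [abs_nonneg z.im]
  have hh1 : ‖h‖ ≤ 1 := by nlinarith [norm_nonneg h]
  have hhs : ‖h‖ ≤ |s| := by nlinarith [norm_nonneg h]
  have hhre : |h.re| ≤ ‖h‖ := Complex.abs_re_le_norm h
  have hhim : |h.im| ≤ ‖h‖ := Complex.abs_im_le_norm h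
  have hzn : |z.im| * n ≤ 1 := by rwa [mul_comm]
  -- (i) the denominator `‖e^{i(z+h)} − 1‖ ≥ e^{-1}|s|`
  have himzh : |(z + h).im| ≤ 2 := by
    rw [Complex.add_im]; exact (abs_add_le _ _).trans (by linarith)
  have hd0 := two_mul_exp_mul_abs_sin_le_norm_of_im (w := z + h) himzh
  have hsin : |s| / 2 ≤ |Real.sin ((z + h).re / 2)| := by
    have hl := Real.abs_sin_sub_sin_le ((z + h).re / 2) (z.re / 2)
    have e : (z + h).re / 2 - z.re / 2 = h.re / 2 := by rw [Complex.add_re]; ring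
    rw [e, abs_div, abs_two, ← hs_def] at hl
    have h3 := abs_sub_abs_le_abs_sub (Real.sin (z.re / 2)) (Real.sin ((z + h).re / 2))
    rw [abs_sub_comm, ← hs_def] at h3
    linarith
  have hden : Real.exp (-1) * |s| ≤ ‖cexp (I * (z + h)) - 1‖ := by
    have e22 : Real.exp (-2 / 2) = Real.exp (-1) := by norm_num
    rw [e22] at hd0
    nlinarith [Real.exp_pos (-1 : ℝ)]
  have hepos : 0 < Real.exp (-1) * |s| := by positivity
  have hden_pos : 0 < ‖cexp (I * (z + h)) - 1‖ := lt_of_lt_of_le hepos hden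
  have hzh1 : cexp (I * (z + h)) ≠ 1 := by
    intro e; rw [e, sub_self, norm_zero] at hden_pos; exact lt_irrefl _ hden_pos
  have hz1 : cexp (I * z) ≠ 1 := cexp_I_mul_ne_one (w := z) (abs_pos.1 hs0)
  -- (ii) the two numerators and the size of `gsum z n`
  have hT1num : ‖cexp (I * (z + h) * n) - cexp (I * z * n)‖ ≤ Real.exp 1 * (2 * (n * ‖h‖)) := by
    have e : cexp (I * (z + h) * n) - cexp (I * z * n) = cexp (I * (z * n)) * (cexp (I * (h * n)) - 1) := by
      rw [show I * (z + h) * (n : ℂ) = I * (z * n) + I * (h * n) by ring, show I * z * (n : ℂ) = I * (z * n) by ring, Complex.exp_add]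
      ring
    rw [e, norm_mul]
    refine mul_le_mul ?_ ?_ (norm_nonneg _) (by positivity)
    · rw [norm_cexp_I_mul]
      refine Real.exp_le_exp.2 ?_
      have him : (z * (n : ℂ)).im = z.im * n := by simp [Complex.mul_im]
      rw [him]; nlinarith [neg_abs_le z.im]
    · have hn1 : ‖h * (n : ℂ)‖ = n * ‖h‖ := by rw [norm_mul, Complex.norm_natCast]; ring
      have h2 := norm_cexp_I_mul_sub_one_le_two_mul (w := h * n) (by rw [hn1]; exact hh)
      rw [hn1] at h2; exact h2
  have hT2num : ‖cexp (I * z) - cexp (I * (z + h))‖ ≤ Real.exp 1 * (2 * ‖h‖) := by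
    have e : cexp (I * z) - cexp (I * (z + h)) = -(cexp (I * z) * (cexp (I * h) - 1)) := by rw [mul_add, Complex.exp_add]; ring
    rw [e, norm_neg, norm_mul]
    exact mul_le_mul ((norm_cexp_I_mul_le z).trans (Real.exp_le_exp.2 hzim)) (norm_cexp_I_mul_sub_one_le_two_mul hh1)
      (norm_nonneg _) (by positivity)
  have hG : ‖gsum z n‖ ≤ n * Real.exp 1 := norm_gsum_le_of_im z n hzn
  -- (iii) assembly
  rw [gsum_add_sub_eq_div n hz1 hzh1]
  have hA : ‖(cexp (I * (z + h) * n) - cexp (I * z * n)) / (cexp (I * (z + h)) - 1)‖ ≤ Real.exp 1 * (2 * (n * ‖h‖)) / (Real.exp (-1) * |s|) := by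
    rw [norm_div]; exact div_le_div₀ (by positivity) hT1num hepos hden
  have hB : ‖gsum z n * ((cexp (I * z) - cexp (I * (z + h))) / (cexp (I * (z + h)) - 1))‖
      ≤ (n * Real.exp 1) * (Real.exp 1 * (2 * ‖h‖) / (Real.exp (-1) * |s|)) := by
    rw [norm_mul, norm_div]
    exact mul_le_mul hG (div_le_div₀ (by positivity) hT2num hepos hden) (by positivity) (by positivity)
  have he := Real.exp_one_lt_d9
  have heinv : Real.exp (-1) * Real.exp 1 = 1 := by rw [← Real.exp_add]; norm_num
  have hE1 : (0.3678 : ℝ) ≤ Real.exp (-1) := by nlinarith [Real.exp_pos (-1 : ℝ), Real.exp_pos (1 : ℝ)]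
  have he2 : Real.exp 1 ^ 2 ≤ 7.3891 := by nlinarith [Real.exp_pos (1 : ℝ)]
  have key : 2 * Real.exp 1 + 2 * Real.exp 1 ^ 2 ≤ 56 * Real.exp (-1) := by nlinarith
  have hnh : 0 ≤ (n : ℝ) * ‖h‖ := by positivity
  have hfin : (2 * Real.exp 1 + 2 * Real.exp 1 ^ 2) * (n * ‖h‖) / Real.exp (-1) ≤ 56 * n * ‖h‖ := by
    rw [div_le_iff₀ (Real.exp_pos _)]
    nlinarith [mul_le_mul_of_nonneg_right key hnh]
  calc ‖(cexp (I * (z + h) * n) - cexp (I * z * n)) / (cexp (I * (z + h)) - 1)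
        + gsum z n * ((cexp (I * z) - cexp (I * (z + h))) / (cexp (I * (z + h)) - 1))‖
      ≤ Real.exp 1 * (2 * (n * ‖h‖)) / (Real.exp (-1) * |s|) + (n * Real.exp 1) * (Real.exp 1 * (2 * ‖h‖) / (Real.exp (-1) * |s|)) :=
        (norm_add_le _ _).trans (add_le_add hA hB)
    _ = (2 * Real.exp 1 + 2 * Real.exp 1 ^ 2) * (n * ‖h‖) / Real.exp (-1) / |s| := by
        field_simp
    _ ≤ 56 * n * ‖h‖ / |s| := div_le_div_of_nonneg_right hfin hs0.le

/-- [folklore] **UNIFIED STRIP-LIPSCHITZ WEIGHT FORM**: `n|Im z| ≤ 1`, `n‖h‖ ≤ 1 ⇒ ‖gsum (z+h) n − gsum z n‖² ≤ 56²·(n‖h‖)²·(n²·sinWt n (Re z))`, i.e.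
`|ΔG| ≤ 56·n‖h‖·min(n, 1/|sin(x/2)|)` — the weight's own majorant times the relative size `n‖h‖` (termwise regime `|sin| ≤ 1/n`, closed form otherwise). -/
theorem norm_gsum_add_sub_sq_le {z h : ℂ} {n : ℕ} (hz : n * |z.im| ≤ 1) (hh : n * ‖h‖ ≤ 1) :
    ‖gsum (z + h) n - gsum z n‖ ^ 2 ≤ 56 ^ 2 * ((n : ℝ) * ‖h‖) ^ 2 * ((n : ℝ) ^ 2 * sinWt n z.re) := by
  set A := ‖gsum (z + h) n - gsum z n‖ with hA_def
  have hA0 : 0 ≤ A := norm_nonneg _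
  have hn0 : (0 : ℝ) ≤ n := Nat.cast_nonneg n
  unfold AliasWeights.sinWt
  rcases le_or_gt (((n : ℝ) * Real.sin (z.re / 2)) ^ 2) 1 with hc | hc
  · rw [max_eq_left hc, div_one, mul_one]
    have h1 : A ≤ 15 * (n : ℝ) ^ 2 * ‖h‖ := norm_gsum_add_sub_le_num hz hh
    have h2 : A ≤ 56 * ((n : ℝ) * ‖h‖) * n := h1.trans (by nlinarith [norm_nonneg h, sq_nonneg (n : ℝ)])
    calc A ^ 2 ≤ (56 * ((n : ℝ) * ‖h‖) * n) ^ 2 := pow_le_pow_left₀ hA0 h2 2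
      _ = 56 ^ 2 * ((n : ℝ) * ‖h‖) ^ 2 * (n : ℝ) ^ 2 := by ring
  · rw [max_eq_right hc.le]
    have hN : (n : ℝ) ≠ 0 := by intro h0; rw [h0, zero_mul] at hc; norm_num at hc
    have hnpos : (0 : ℝ) < n := lt_of_le_of_ne hn0 (Ne.symm hN)
    have hn : 1 ≤ n := Nat.one_le_iff_ne_zero.2 (by exact_mod_cast hN)
    have hs1 : 1 < (n : ℝ) * |Real.sin (z.re / 2)| := by
      have h2 : (1 : ℝ) ^ 2 < ((n : ℝ) * |Real.sin (z.re / 2)|) ^ 2 := by rw [one_pow, mul_pow, sq_abs, ← mul_pow]; exact hc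
      exact lt_of_pow_lt_pow_left₀ 2 (by positivity) h2
    have hs : 1 / (n : ℝ) ≤ |Real.sin (z.re / 2)| := by
      rw [div_le_iff₀ hnpos]; linarith [mul_comm (n : ℝ) |Real.sin (z.re / 2)|]
    have hs0 : 0 < |Real.sin (z.re / 2)| := lt_of_lt_of_le (by positivity) hs
    have h1 := norm_gsum_add_sub_le_inv_sin hn hz hh hs
    calc A ^ 2 ≤ (56 * n * ‖h‖ / |Real.sin (z.re / 2)|) ^ 2 := pow_le_pow_left₀ hA0 h1 2
      _ = 56 ^ 2 * ((n : ℝ) * ‖h‖) ^ 2 * ((n : ℝ) ^ 2 * (1 / ((n : ℝ) * Real.sin (z.re / 2)) ^ 2)) := by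
          rw [div_pow, sq_abs, mul_pow (n : ℝ) (Real.sin _)]
          field_simp

end Summit.QuantumFields.BalabanUV.Beta.GAN24.AliasStripSymbolsSum

end
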